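import Summits.ResolutionOfSingularities.ResolutionOfSingularities.Theorems.EquisingularLiftEquisingularLiftNatNDChartPullback
import HarnessLib

/-!
# [OURS · L1 W4.5(b) · EL♮(3)] ND CHART DICTIONARY (2/3) — `…NatNDChartEnd`: THE END lemma in Jacobian form `exists_eval_pderiv_toricStrict_ne_zero`
# (Khovanskii 1977 / Ishii, Introduction to Singularities, Lemma 4.4.24, chart computation, characteristic-free): `det B ≠ 0` in `k`, `g` locally Newton-nondegenerate,
# the face `τ_I` not `Bad`, positive `I`-weights ⟹ at every point of the orbit `{y_i = 0 (i ∈ I), y_j ≠ 0 (j ∉ I)}` on the strict transform some orbit partial is non-zero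

OURS · L1 W4.5(b) · EL♮(3) stmt-ResolutionOfSingularities-20148 · counted 0 · AI-written (res-L1-w45b-idea-1 g22; landed in the text owner's lane by res-L1-w45b-lead-2 g6 on
idea-1's OFFER R8-4), weaker than expert review; nothing of [Hironaka2017] asserted; no statement of the manuscript. Sorry-free, axioms standard, no instance, no
notation. `--supports stmt-ResolutionOfSingularities-20148 --as helper`: support module toward the registered 4th CHILD stub
`stub_elnat_three_isolated_newtonNondegenerate` (`IsoHypNDWon → ELNatConclusionO`, first unproved lemma `nd_rung_local`): this is the PROVED `k`-SIDE of that
rung's toric dictionary; the `O`-side plumbing (O1)–(O5) of `Cruxes/EquisingularLiftNatThree/NewtonNondegenerateRung.lean` §10.3 is untouched.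
SOURCE = idea-1's companion `Cruxes/EquisingularLiftNatThree/NewtonNondegenerateRungCharts.lean` sha16 54ad50e211ef87b7 (658 l., farm rc 0 · 0 sorries), bodies
VERBATIM; tree home = namespace `…Cruxes.EquisingularLiftNat.Sections.ND` (text owner's ruling on R8-4), imports route-independent, prelude lemmas public, split by
the 400-line rule into `…NatNDChartPullback` (§12.1–§12.2) → `…NatNDChartEnd` (§12.3) → `…NatNDChartPlays` (§12.4–§12.6).
-/

noncomputable section

set_option linter.dupNamespace false

open MvPolynomial

namespace Summit.ResolutionOfSingularities.ResolutionOfSingularities.Cruxes.EquisingularLiftNat.Sections.ND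

open Summit.ResolutionOfSingularities.ResolutionOfSingularities.Cruxes.EquisingularLiftNat.Sections

variable {k : Type} [Field k] {N : ℕ} {n : ℕ}

/-! ### 12.3 THE END DICTIONARY — Khovanskii's chart lemma in Jacobian form (PROVED) -/

/-- `x_l · (∂_l (a·x^s))(x) = a · s_l · x^s` (Euler on one monomial, evaluated). -/
theorem mul_eval_pderiv_monomial (x : Fin n → k) (l : Fin n) (s : Fin n →₀ ℕ) (a : k) :
    x l * eval x (pderiv l (monomial s a)) = a * (s l : k) * ∏ i, x i ^ s i := by
  have h := congrArg (eval x) (X_mul_pderiv_monomial (i := l) (m := s) (r := a))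
  rw [map_mul, eval_X, map_nsmul, eval_monomial, Finsupp.prod_fintype _ _ (fun _ => pow_zero _), nsmul_eq_mul] at h
  rw [h]; ring

/-- **THE END OF THE WALK, chart by chart (PROVED).**  Let `B` be the ray matrix of a chart with `det B ≠ 0` in `k` (e.g. a smooth cone: `det B = ±1`),
`g` LOCALLY Newton-nondegenerate, `I` a set of chart rays whose face `τ_I` is NOT `Bad` (as every face is at a `Won` position, `bad_mono`) and whose orbit
`O_I = {y_i = 0 (i ∈ I), y_j ≠ 0 (j ∉ I)}` lies OVER THE ORIGIN (the weight `Σ_{i∈I} B i` is positive).  Then at every point of `O_I` on the strict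
transform some partial `∂_j`, `j ∉ I` — a direction TANGENT to the orbit — does not vanish: by the Jacobian criterion the strict transform is smooth
there of codimension one and transversal to `O_I`.  (Proof = Ishii Lemma 4.4.24 / Khovanskii 1977: the face of `Γ(g)` selected by `τ_I` is the
initial form `g_w`, `w = Σ_I B i`; `g_w(ỹ^B) = ỹ^h · G(y)` for the torus point `ỹ` (`= y` off `I`, `= 1` on `I`); the Euler rows
`Σ_l B i l · t_l ∂_l g_w(t)` are `0` for `i ∈ I` and `ỹ^h · y_j ∂_j G(y)` for `j ∉ I`; `det B ≠ 0` and local ND finish.)  Characteristic-free. -/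
theorem exists_eval_pderiv_toricStrict_ne_zero (B : Fin n → Fin n → ℕ)
    (hB : (Matrix.of fun i l => (B i l : k)).det ≠ 0)
    {g : MvPolynomial (Fin n) k} (hND : IsLocallyNewtonNondegenerate g)
    (I : Finset (Fin n)) (hI : ¬ Bad (table g) (I.image fun i => rayOf (B i)))
    (hw : ∀ l, ∃ i ∈ I, 0 < B i l)
    (y : Fin n → k) (hy0 : ∀ i ∈ I, y i = 0) (hy1 : ∀ j, j ∉ I → y j ≠ 0)
    (hGy : eval y (toricStrict B g) = 0) :
    ∃ j, j ∉ I ∧ eval y (pderiv j (toricStrict B g)) ≠ 0 := by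
  classical
  have hg : g ≠ 0 := ne_zero_of_isLocallyND hND
  have hsup : g.support.Nonempty := support_nonempty.2 hg
  have hVne : (table g).Nonempty := table_nonempty hg
  -- (1) the simultaneous minimiser given by `¬ Bad`
  have hI' : ∃ m₀ ∈ table g, ∀ i ∈ I, pairN (B i) m₀ = hminN (table g) (B i) := by
    by_contra hcon
    apply hI
    rintro ⟨m₀, hm₀, hmin⟩
    apply hcon
    refine ⟨m₀, hm₀, fun i hi => le_antisymm ?_ (hminN_le (B i) hm₀)⟩
    obtain ⟨m', hm', hm'eq⟩ := exists_pairN_eq_hminN hVne (B i)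
    rw [← hm'eq]
    have := hmin (rayOf (B i)) (Finset.mem_image_of_mem _ hi) m' hm'
    rwa [pair_rayOf, pair_rayOf, Nat.cast_le] at this
  obtain ⟨m₀, hm₀, hm₀min⟩ := hI'
  -- (2) the positive weight selecting the face of `τ_I`
  set w : Fin n → ℤ := fun l => ∑ i ∈ I, (B i l : ℤ) with hw'
  have hwpos : ∀ l, 0 < w l := by
    intro l
    obtain ⟨i, hi, hil⟩ := hw l
    exact Finset.sum_pos' (fun j _ => by positivity) ⟨i, hi, by exact_mod_cast hil⟩
  have hwt : ∀ d : Fin n →₀ ℕ, wt w d = ∑ i ∈ I, (pairN (B i) ⇑d : ℤ) := by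
    intro d
    simp only [wt, hw', pairN, Nat.cast_sum, Nat.cast_mul, Finset.sum_mul]
    rw [Finset.sum_comm]
  have hinf : g.support.inf' hsup (wt w) = ∑ i ∈ I, (hminN (table g) (B i) : ℤ) := by
    apply le_antisymm
    · have := Finset.inf'_le (wt w) (mem_table_iff.1 hm₀)
      rw [hwt, coe_toFs] at this
      refine this.trans (le_of_eq (Finset.sum_congr rfl fun i hi => by rw [hm₀min i hi]))
    · refine Finset.le_inf' _ _ fun d hd => ?_
      rw [hwt]
      exact Finset.sum_le_sum fun i hi => by exact_mod_cast hminN_le (B i) (coe_mem_table hd)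
  have hface : ∀ d ∈ g.support,
      (wt w d = g.support.inf' hsup (wt w) ↔ ∀ i ∈ I, pairN (B i) ⇑d = hminN (table g) (B i)) := by
    intro d hd
    rw [hinf, hwt]
    constructor
    · intro heq
      have hle : ∀ i ∈ I, (hminN (table g) (B i) : ℤ) ≤ pairN (B i) ⇑d := fun i hi => by
        exact_mod_cast hminN_le (B i) (coe_mem_table hd)
      have hz : ∑ i ∈ I, ((pairN (B i) ⇑d : ℤ) - hminN (table g) (B i)) = 0 := by
        rw [Finset.sum_sub_distrib, heq, sub_self]
      intro i hi
      have := (Finset.sum_eq_zero_iff_of_nonneg (fun j hj => sub_nonneg.2 (hle j hj))).1 hz i hi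
      exact_mod_cast (sub_eq_zero.1 this)
    · intro hall
      exact Finset.sum_congr rfl fun i hi => by rw [hall i hi]
  -- the face family `S` and the initial form
  set S := g.support.filter (fun d => wt w d = g.support.inf' hsup (wt w)) with hS
  have hinit : initialForm w g = ∑ d ∈ S, monomial d (coeff d g) := by
    unfold initialForm; rw [dif_pos hsup]
  have hSsub : S ⊆ g.support := Finset.filter_subset _ _
  have hSmem : ∀ d, d ∈ S ↔ d ∈ g.support ∧ ∀ i ∈ I, pairN (B i) ⇑d = hminN (table g) (B i) := by
    intro d; rw [hS, Finset.mem_filter]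
    constructor
    · rintro ⟨hd, h1⟩; exact ⟨hd, (hface d hd).1 h1⟩
    · rintro ⟨hd, h1⟩; exact ⟨hd, (hface d hd).2 h1⟩
  have hSexp : ∀ d ∈ S, ∀ i ∈ I, strictExp B (table g) ⇑d i = 0 := by
    intro d hd i hi
    simp only [strictExp]; rw [((hSmem d).1 hd).2 i hi]; exact Nat.sub_self _
  -- off the face, the strict monomial vanishes on `{y_i = 0, i ∈ I}`
  have hvan : ∀ d ∈ g.support, d ∉ S → (∏ i, y i ^ strictExp B (table g) ⇑d i) = 0 := by
    intro d hd hdS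
    have : ∃ i ∈ I, strictExp B (table g) ⇑d i ≠ 0 := by
      by_contra hcon
      simp only [not_exists, not_and, not_not] at hcon
      apply hdS
      rw [hSmem]
      exact ⟨hd, fun i hi => le_antisymm (Nat.sub_eq_zero_iff_le.1 (hcon i hi)) (hminN_le (B i) (coe_mem_table hd))⟩
    obtain ⟨i, hi, hne⟩ := this
    exact Finset.prod_eq_zero (Finset.mem_univ i) (by rw [hy0 i hi, zero_pow hne])
  -- (3) the torus point `ỹ` and its image `t = ỹ^B`
  set yt : Fin n → k := fun j => if j ∈ I then 1 else y j with hyt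
  have hyt0 : ∀ j, yt j ≠ 0 := by
    intro j; simp only [hyt]; split_ifs with hj
    · exact one_ne_zero
    · exact hy1 j hj
  set t : Fin n → k := fun l => ∏ i, yt i ^ B i l with ht
  have ht0 : ∀ l, t l ≠ 0 := fun l => Finset.prod_ne_zero_iff.2 fun i _ => pow_ne_zero _ (hyt0 i)
  have hmon : ∀ d : Fin n →₀ ℕ, (∏ l, t l ^ d l) = ∏ i, yt i ^ chartExp B ⇑d i := by
    intro d
    have h1 : ∀ l, t l ^ (d l) = ∏ i, yt i ^ (B i l * d l) := fun l => by
      simp only [ht]; rw [← Finset.prod_pow]; exact Finset.prod_congr rfl fun i _ => (pow_mul _ _ _).symm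
    simp only [h1, chartExp, pairN]
    rw [Finset.prod_comm]
    exact Finset.prod_congr rfl fun i _ => Finset.prod_pow_eq_pow_sum _ _ _
  set U : k := ∏ i, yt i ^ hminN (table g) (B i) with hU
  have hU0 : U ≠ 0 := Finset.prod_ne_zero_iff.2 fun i _ => pow_ne_zero _ (hyt0 i)
  have hmonS : ∀ d ∈ S, (∏ i, yt i ^ chartExp B ⇑d i) = U * ∏ i, y i ^ strictExp B (table g) ⇑d i := by
    intro d hd
    rw [hU, ← Finset.prod_mul_distrib]
    refine Finset.prod_congr rfl fun i _ => ?_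
    rw [← strictExp_add_hminN B (coe_mem_table (hSsub hd)) i, pow_add, mul_comm]
    congr 1
    by_cases hi : i ∈ I
    · rw [hSexp d hd i hi, pow_zero, pow_zero]
    · simp only [hyt, if_neg hi]
  -- (4) `g_w(t) = U · G(y) = 0`
  have hevalG : eval y (toricStrict B g) = ∑ d ∈ S, coeff d g * ∏ i, y i ^ strictExp B (table g) ⇑d i := by
    unfold toricStrict
    rw [map_sum, hS, Finset.sum_filter]
    refine Finset.sum_congr rfl fun d hd => ?_
    rw [eval_monomial, Finsupp.prod_fintype _ _ fun _ => pow_zero _]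
    simp only [toFs_apply]
    split_ifs with hP
    · rfl
    · rw [hvan d hd (by rw [hSmem]; exact fun h' => hP ((hface d hd).2 h'.2)), mul_zero]
  have hevalInit : eval t (initialForm w g) = U * eval y (toricStrict B g) := by
    rw [hinit, map_sum, hevalG, Finset.mul_sum]
    refine Finset.sum_congr rfl fun d hd => ?_
    rw [eval_monomial, Finsupp.prod_fintype _ _ fun _ => pow_zero _, hmon d, hmonS d hd]
    ring
  have hInit0 : eval t (initialForm w g) = 0 := by rw [hevalInit, hGy, mul_zero]
  -- (5) the derivatives of `G` along the orbit directions
  have hderivG : ∀ j, y j * eval y (pderiv j (toricStrict B g)) =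
      ∑ d ∈ S, coeff d g * (strictExp B (table g) ⇑d j : k) * ∏ i, y i ^ strictExp B (table g) ⇑d i := by
    intro j
    unfold toricStrict
    rw [map_sum, map_sum, Finset.mul_sum, hS, Finset.sum_filter]
    refine Finset.sum_congr rfl fun d hd => ?_
    rw [mul_eval_pderiv_monomial]
    simp only [toFs_apply]
    split_ifs with hP
    · rfl
    · rw [hvan d hd (by rw [hSmem]; exact fun h' => hP ((hface d hd).2 h'.2)), mul_zero]
  -- (6) the Euler rows `Σ_l B i l · t_l ∂_l g_w(t)`
  set u : Fin n → k := fun l => t l * eval t (pderiv l (initialForm w g)) with hu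
  have hul : ∀ l, u l = ∑ d ∈ S, coeff d g * (d l : k) * ∏ i', yt i' ^ chartExp B ⇑d i' := by
    intro l
    simp only [hu]
    rw [hinit, map_sum, map_sum, Finset.mul_sum]
    refine Finset.sum_congr rfl fun d hd => ?_
    rw [mul_eval_pderiv_monomial, hmon d]
  have hrow : ∀ i, ∑ l, (B i l : k) * u l =
      ∑ d ∈ S, coeff d g * (pairN (B i) ⇑d : k) * ∏ i', yt i' ^ chartExp B ⇑d i' := by
    intro i
    calc ∑ l, (B i l : k) * u l
        = ∑ l, ∑ d ∈ S, (B i l : k) * (coeff d g * (d l : k) * ∏ i', yt i' ^ chartExp B ⇑d i') := by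
          refine Finset.sum_congr rfl fun l _ => ?_; rw [hul l, Finset.mul_sum]
      _ = ∑ d ∈ S, ∑ l, (B i l : k) * (coeff d g * (d l : k) * ∏ i', yt i' ^ chartExp B ⇑d i') := Finset.sum_comm
      _ = ∑ d ∈ S, coeff d g * (pairN (B i) ⇑d : k) * ∏ i', yt i' ^ chartExp B ⇑d i' := by
          refine Finset.sum_congr rfl fun d _ => ?_
          simp only [pairN, Nat.cast_sum, Nat.cast_mul, Finset.sum_mul, Finset.mul_sum]
          refine Finset.sum_congr rfl fun l _ => ?_; ring
  -- (7) suppose every orbit-direction partial vanishes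
  by_contra hcon
  simp only [not_exists, not_and, not_not] at hcon
  have hrows : ∀ i, ∑ l, (B i l : k) * u l = 0 := by
    intro i
    rw [hrow i]
    by_cases hi : i ∈ I
    · calc ∑ d ∈ S, coeff d g * (pairN (B i) ⇑d : k) * ∏ i', yt i' ^ chartExp B ⇑d i'
          = (hminN (table g) (B i) : k) * eval t (initialForm w g) := by
            rw [hinit, map_sum, Finset.mul_sum]
            refine Finset.sum_congr rfl fun d hd => ?_
            rw [((hSmem d).1 hd).2 i hi, eval_monomial, Finsupp.prod_fintype _ _ fun _ => pow_zero _, hmon d]; ring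
        _ = 0 := by rw [hInit0, mul_zero]
    · calc ∑ d ∈ S, coeff d g * (pairN (B i) ⇑d : k) * ∏ i', yt i' ^ chartExp B ⇑d i'
          = (hminN (table g) (B i) : k) * eval t (initialForm w g) + U * (y i * eval y (pderiv i (toricStrict B g))) := by
            rw [hinit, map_sum, Finset.mul_sum, hderivG i, Finset.mul_sum, ← Finset.sum_add_distrib]
            refine Finset.sum_congr rfl fun d hd => ?_
            rw [eval_monomial, Finsupp.prod_fintype _ _ fun _ => pow_zero _, hmon d, hmonS d hd,
              show (pairN (B i) ⇑d : k) = (strictExp B (table g) ⇑d i : k) + (hminN (table g) (B i) : k) by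
                have h' := strictExp_add_hminN B (coe_mem_table (hSsub hd)) i
                simp only [chartExp] at h'
                rw [← Nat.cast_add, h']]
            ring
        _ = 0 := by rw [hInit0, hcon i hi, mul_zero, mul_zero, mul_zero, add_zero]
  have hu0 : u = 0 := by
    apply Matrix.eq_zero_of_mulVec_eq_zero hB
    funext i
    simpa [Matrix.mulVec, dotProduct] using hrows i
  have hpd : ∀ l, eval t (pderiv l (initialForm w g)) = 0 := by
    intro l
    have := congrFun hu0 l
    simp only [hu, Pi.zero_apply, mul_eq_zero] at this
    exact this.resolve_left (ht0 l)
  exact hND w hwpos t ht0 hInit0 hpd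

end Summit.ResolutionOfSingularities.ResolutionOfSingularities.Cruxes.EquisingularLiftNat.Sections.ND

end
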